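import Summits.Ventures.Crystal3D.Theorems.StickyWulffConstantGenericWallFloorStackWalkWordSepFarTwo
import Summits.Ventures.Crystal3D.Theorems.StickyWulffConstantCoaxialWallLawExitsBelow
import HarnessLib

/-!
# The ONE co-axial cross pair on the one-sided `Σ9` core is the in-plane twin pair (crux `GenericWallFloor`, `WallLedgerG`)

HONEST FRAMING. Venture `Summits/Ventures/Crystal3D` (cell `crystal3d-full`), helper `--supports` the crux
`GenericWallFloor` (stmt-Ventures-19480), REGISTERED line `WallLedgerG`, open stub `stub_twoSlabAdhesion`.  Rung credit
only; F-C1 not moved; NOT the crux.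
THE CLASS.  A `Σ9` pair `A₂·Λ₀ = (wordFrame A₁ [μk, μk1])·Λ₀` (reduced two-letter model menu word; first mirror
`n = A₁ μk1`, then `m`); a steep slot `u₁` of grain 1 IN the first mirror plane (`⟪u₁, μk1⟫ = 0`); the far grain free at
level one (its walkers may push into the lamella `T = R_m A₂`) with the LEVEL-TWO hypothesis of `…WordSepFarTwo`
(`hsecond`: the lamella's best capper does not force `n` next — grain 2's forced ray misses `A₁·Λ₀`) and its geometric
reading `hcap` (that capper lies IN the plane `n`; the two are equivalent readings of one checkable condition; the class
is the one-sided `Σ9` class of `…AtHalf`, numerically `94 %` of Haar orientations for some choice of sides).  At twin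
distance `≥ 3` these hypotheses SEPARATE the grains (`not_coaxial_of_word_farTwo`); at distance `2` exactly one co-axial
cross pair survives: **`inPlaneTwin_of_coaxial_sigma9`** — if the tops of a sound well-formed grain-1 stack and of a
sound well-formed grain-2 stack carry CO-AXIAL frames, then the grain-1 stack is the bare bottom `(A₁, u₁, 0)`, the
grain-2 top's lattice is the mirror twin of `A₁·Λ₀` about `ν = A₁ μk1`, and BOTH top directions lie in that plane —
the hypothesis list of the stars-only input `InPlaneTwinStarPair`.  Proof: `not_coaxial_of_word_farTwo`'s word analysis
with empty path tail; every branch is absurd except the cancelled junction with a one-letter far word and an empty near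
word.  The `c₀ = 1` assembly is the sequel `…Sigma9Full`.
WHAT THIS IS NOT: not the stub; nothing is certified here; F-C1 not moved.
-/

noncomputable section

namespace Summit.Ventures.Crystal3D.Theorems

open Summit.Ventures.Crystal3D Finset
open Literature.MathematicalPhysics.StatisticalMechanics (fccStacking barlowStacking IsHaggSeq)
open scoped InnerProductSpace

/-- **The co-axial cross pair on the one-sided `Σ9` class is the in-plane twin pair.**  See the module docstring. -/
theorem inPlaneTwin_of_coaxial_sigma9 {A₁ A₂ : EuclideanSpace ℝ (Fin 3) ≃ₗᵢ[ℝ] EuclideanSpace ℝ (Fin 3)}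
    {u₁ u₂ : EuclideanSpace ℝ (Fin 3)} (μk μk1 : EuclideanSpace ℝ (Fin 3))
    (hκl : ∀ μ ∈ [μk, μk1], ‖μ‖ = 1 ∧
      ∀ w ∈ fccSlots, ⟪w, μ⟫_ℝ = 0 ∨ ⟪w, μ⟫_ℝ = Real.sqrt (2 / 3) ∨ ⟪w, μ⟫_ℝ = -Real.sqrt (2 / 3))
    (hκc : List.IsChain (fun μ μ' => ⟪μ, μ'⟫_ℝ = 1 / 3 ∨ ⟪μ, μ'⟫_ℝ = -1 / 3) [μk, μk1])
    (hA₂ : A₂ '' fccStacking 1 (Real.sqrt (2 / 3)) = (wordFrame A₁ [μk, μk1]) '' fccStacking 1 (Real.sqrt (2 / 3)))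
    (hfirst : ⟪u₁, μk1⟫_ℝ = 0)
    {z₂ : EuclideanSpace ℝ (Fin 3)}
    (hsecond : ∀ n₁ : EuclideanSpace ℝ (Fin 3),
      (n₁ = wordFrame A₁ [μk, μk1] μk ∨ n₁ = -wordFrame A₁ [μk, μk1] μk) → ⟪A₂ u₂, n₁⟫_ℝ = Real.sqrt (2 / 3) →
      ∀ q ∈ fccSlots, 0 < ⟪twinFrame A₂ n₁ q, n₁⟫_ℝ →
        (∀ q' ∈ fccSlots, 0 < ⟪twinFrame A₂ n₁ q', n₁⟫_ℝ → ⟪twinFrame A₂ n₁ q', z₂⟫_ℝ ≤ ⟪twinFrame A₂ n₁ q, z₂⟫_ℝ) →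
        (wordFrame A₁ [μk, μk1]).symm (A₂ ((twinFrame A₂ n₁).symm ((2 * Real.sqrt (2 / 3)) • twinFrame A₂ n₁ q - n₁))) ≠ μk1 ∧
        (wordFrame A₁ [μk, μk1]).symm (A₂ ((twinFrame A₂ n₁).symm ((2 * Real.sqrt (2 / 3)) • twinFrame A₂ n₁ q - n₁))) ≠ -μk1)
    (hcap : ∀ n₁ : EuclideanSpace ℝ (Fin 3),
      (n₁ = wordFrame A₁ [μk, μk1] μk ∨ n₁ = -wordFrame A₁ [μk, μk1] μk) → ⟪A₂ u₂, n₁⟫_ℝ = Real.sqrt (2 / 3) →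
      ∀ q ∈ fccSlots, 0 < ⟪twinFrame A₂ n₁ q, n₁⟫_ℝ →
        (∀ q' ∈ fccSlots, 0 < ⟪twinFrame A₂ n₁ q', n₁⟫_ℝ → ⟪twinFrame A₂ n₁ q', z₂⟫_ℝ ≤ ⟪twinFrame A₂ n₁ q, z₂⟫_ℝ) →
        ⟪twinFrame A₂ n₁ q, A₁ μk1⟫_ℝ = 0)
    {z₁ : EuclideanSpace ℝ (Fin 3)} {e₁ e₂ : WalkEntry} {rest₁ rest₂ : List WalkEntry}
    (hS₁ : StackSound z₁ (e₁ :: rest₁)) (hW₁ : StackWF z₁ (e₁ :: rest₁)) (hl₁ : (e₁ :: rest₁).getLast? = some ⟨A₁, u₁, 0⟩)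
    (hS₂ : StackSound z₂ (e₂ :: rest₂)) (hW₂ : StackWF z₂ (e₂ :: rest₂)) (hl₂ : (e₂ :: rest₂).getLast? = some ⟨A₂, u₂, 0⟩)
    (hco : ∃ (L : EuclideanSpace ℝ (Fin 3) ≃ₗᵢ[ℝ] EuclideanSpace ℝ (Fin 3))
        (s₁ s₂ : EuclideanSpace ℝ (Fin 3)) (σ σ' : ℤ → ℤ), IsHaggSeq σ ∧ IsHaggSeq σ' ∧
        e₁.frame '' fccStacking 1 (Real.sqrt (2 / 3)) ⊆ (fun p => L p + s₁) '' barlowStacking 1 (Real.sqrt (2 / 3)) σ ∧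
        e₂.frame '' fccStacking 1 (Real.sqrt (2 / 3)) ⊆ (fun p => L p + s₂) '' barlowStacking 1 (Real.sqrt (2 / 3)) σ') :
    ‖A₁ μk1‖ = 1 ∧
    (∀ w ∈ fccSlots, ⟪e₁.frame w, A₁ μk1⟫_ℝ = 0 ∨ ⟪e₁.frame w, A₁ μk1⟫_ℝ = Real.sqrt (2 / 3) ∨
      ⟪e₁.frame w, A₁ μk1⟫_ℝ = -Real.sqrt (2 / 3)) ∧
    e₂.frame '' fccStacking 1 (Real.sqrt (2 / 3)) = twinFrame e₁.frame (A₁ μk1) '' fccStacking 1 (Real.sqrt (2 / 3)) ∧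
    ⟪e₁.frame e₁.dir, A₁ μk1⟫_ℝ = 0 ∧ ⟪e₂.frame e₂.dir, A₁ μk1⟫_ℝ = 0 := by
  set κ := [μk, μk1] with hκdef
  have hr : 0 < Real.sqrt (2 / 3) := Real.sqrt_pos.2 (by norm_num)
  have hμk := hκl μk (by rw [hκdef]; simp)
  have hμk1 := hκl μk1 (by rw [hκdef]; simp)
  have hκlast : κ.getLast? = some μk1 := rfl
  have hκ2 : 2 ≤ κ.length := by simp [hκdef]
  have hν1 : ‖A₁ μk1‖ = 1 := by rw [LinearIsometryEquiv.norm_map, hμk1.1]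
  -- the two stack words
  obtain ⟨hαl, hαc⟩ := stackWord_letters _ hS₁ hW₁
  obtain ⟨hβl, hβc⟩ := stackWord_letters _ hS₂ hW₂
  have hF₁ : e₁.frame = wordFrame A₁ (stackWord (e₁ :: rest₁)) := by
    rw [frame_eq_wordFrame e₁ rest₁ hS₁, stackBase_eq_of_getLast? hl₁]
  have hF₂ : e₂.frame = wordFrame A₂ (stackWord (e₂ :: rest₂)) := by
    rw [frame_eq_wordFrame e₂ rest₂ hS₂, stackBase_eq_of_getLast? hl₂]
  have hαpos : ∀ μ, (stackWord (e₁ :: rest₁)).getLast? = some μ → ⟪u₁, μ⟫_ℝ = Real.sqrt (2 / 3) :=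
    fun μ hμ => inner_dir_getLast_stackWord rest₁ e₁ ⟨A₁, u₁, 0⟩ hS₁ hl₁ μ hμ
  -- the lattice symmetry `S = W⁻¹ ∘ A₂`
  obtain ⟨S, hS⟩ : ∃ S : EuclideanSpace ℝ (Fin 3) ≃ₗᵢ[ℝ] EuclideanSpace ℝ (Fin 3), S = A₂.trans (wordFrame A₁ κ).symm := ⟨_, rfl⟩
  have hWS : ∀ x, wordFrame A₁ κ (S x) = A₂ x := fun x => by
    rw [hS, LinearIsometryEquiv.trans_apply, LinearIsometryEquiv.apply_symm_apply]
  have hA₂eq : A₂ = S.trans (wordFrame A₁ κ) :=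
    LinearIsometryEquiv.ext fun x => by rw [LinearIsometryEquiv.trans_apply, hWS]
  have hSfcc : S '' fccStacking 1 (Real.sqrt (2 / 3)) = fccStacking 1 (Real.sqrt (2 / 3)) := by
    rw [hS, LinearIsometryEquiv.coe_trans, Set.image_comp, hA₂, Set.image_image]; simp
  have hSslots := image_fccSlots_eq_self_of_image_fcc S hSfcc
  have hSmem' : ∀ w ∈ fccSlots, S.symm w ∈ fccSlots := fun w hw => by
    have hw' : w ∈ (S : EuclideanSpace ℝ (Fin 3) → EuclideanSpace ℝ (Fin 3)) '' ↑fccSlots := by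
      rw [hSslots]; exact Finset.mem_coe.2 hw
    obtain ⟨w', hw', hw'eq⟩ := hw'; rw [← hw'eq, LinearIsometryEquiv.symm_apply_apply]; exact Finset.mem_coe.1 hw'
  -- the far word and its transport
  set β := stackWord (e₂ :: rest₂) with hβ
  have hβSl : ∀ μ ∈ β.map S, ‖μ‖ = 1 ∧
      ∀ w ∈ fccSlots, ⟪w, μ⟫_ℝ = 0 ∨ ⟪w, μ⟫_ℝ = Real.sqrt (2 / 3) ∨ ⟪w, μ⟫_ℝ = -Real.sqrt (2 / 3) := by
    intro μ hμ; obtain ⟨ν, hν, rfl⟩ := List.mem_map.1 hμ; obtain ⟨hνu, hνm⟩ := hβl ν hν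
    refine ⟨by rw [LinearIsometryEquiv.norm_map, hνu], fun w hw => ?_⟩
    have hsw : ⟪w, S ν⟫_ℝ = ⟪S.symm w, ν⟫_ℝ := by
      rw [← LinearIsometryEquiv.inner_map_map S (S.symm w) ν, LinearIsometryEquiv.apply_symm_apply]
    rw [hsw]; exact hνm _ (hSmem' w hw)
  have hβSc : List.IsChain (fun μ μ' => ⟪μ, μ'⟫_ℝ = 1 / 3 ∨ ⟪μ, μ'⟫_ℝ = -1 / 3) (β.map S) := by
    rw [List.isChain_map]; simpa only [LinearIsometryEquiv.inner_map_map] using hβc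
  have himg₀ : (e₂.frame : EuclideanSpace ℝ (Fin 3) → EuclideanSpace ℝ (Fin 3)) '' ↑fccSlots =
      (wordFrame A₁ (β.map S ++ κ) : EuclideanSpace ℝ (Fin 3) → EuclideanSpace ℝ (Fin 3)) '' ↑fccSlots := by
    rw [hF₂, hA₂eq, wordFrame_trans (wordFrame A₁ κ) S β (fun μ hμ => (hβl μ hμ).1), ← wordFrame_append,
      image_trans_eq, hSslots]
  have hP2far := stackWord_lastTwo_ne_far (A₂ := A₂) (W := wordFrame A₁ κ) (S := S) (z₂ := z₂) hWS hμk.1 hμk1.1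
    hsecond rest₂ e₂ hS₂ hW₂ hl₂
  have hjunction : ∀ x y : EuclideanSpace ℝ (Fin 3),
      (‖x‖ = 1 ∧ ∀ w ∈ fccSlots, ⟪w, x⟫_ℝ = 0 ∨ ⟪w, x⟫_ℝ = Real.sqrt (2 / 3) ∨ ⟪w, x⟫_ℝ = -Real.sqrt (2 / 3)) →
      (‖y‖ = 1 ∧ ∀ w ∈ fccSlots, ⟪w, y⟫_ℝ = 0 ∨ ⟪w, y⟫_ℝ = Real.sqrt (2 / 3) ∨ ⟪w, y⟫_ℝ = -Real.sqrt (2 / 3)) →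
      (ℝ ∙ x)ᗮ.reflection ≠ (ℝ ∙ y)ᗮ.reflection → (⟪x, y⟫_ℝ = 1 / 3 ∨ ⟪x, y⟫_ℝ = -1 / 3) := by
    intro x y hx hy hR; rcases inner_modelMenu hx.1 hy.1 hx.2 hy.2 with h | h | h | h
    · exact absurd (by rw [(inner_eq_one_iff_of_norm_eq_one (𝕜 := ℝ) hx.1 hy.1).1 h]) hR
    · exact absurd (by rw [eq_neg_of_inner_eq_neg_one' hx.1 hy.1 h, reflection_neg_eq hx.1]) hR
    · exact Or.inl h
    · exact Or.inr h
  -- the main contradiction step: a reduced far word of length `≥ 2` ending with `μk1` cannot be co-axial with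
  -- the near frame (as in `not_coaxial_of_word` / `…_farTwo`)
  have absurd_of_far : ∀ γ : List (EuclideanSpace ℝ (Fin 3)),
      (∀ μ ∈ γ, ‖μ‖ = 1 ∧
        ∀ w ∈ fccSlots, ⟪w, μ⟫_ℝ = 0 ∨ ⟪w, μ⟫_ℝ = Real.sqrt (2 / 3) ∨ ⟪w, μ⟫_ℝ = -Real.sqrt (2 / 3)) →
      List.IsChain (fun μ μ' => ⟪μ, μ'⟫_ℝ = 1 / 3 ∨ ⟪μ, μ'⟫_ℝ = -1 / 3) γ → 2 ≤ γ.length →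
      (∃ μ, γ.getLast? = some μ ∧ ⟪u₁, μ⟫_ℝ = 0) →
      (e₂.frame : EuclideanSpace ℝ (Fin 3) → EuclideanSpace ℝ (Fin 3)) '' ↑fccSlots =
        (wordFrame A₁ γ : EuclideanSpace ℝ (Fin 3) → EuclideanSpace ℝ (Fin 3)) '' ↑fccSlots → False := by
    intro γ hγl hγc hγ2 hγlast himg₂
    have main : ∀ α : List (EuclideanSpace ℝ (Fin 3)),
        (∀ μ ∈ α, ‖μ‖ = 1 ∧
          ∀ w ∈ fccSlots, ⟪w, μ⟫_ℝ = 0 ∨ ⟪w, μ⟫_ℝ = Real.sqrt (2 / 3) ∨ ⟪w, μ⟫_ℝ = -Real.sqrt (2 / 3)) →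
        List.IsChain (fun μ μ' => ⟪μ, μ'⟫_ℝ = 1 / 3 ∨ ⟪μ, μ'⟫_ℝ = -1 / 3) α →
        (α.length ≤ 1 ∨ ∃ lam, α.getLast? = some lam ∧ ⟪u₁, lam⟫_ℝ = Real.sqrt (2 / 3)) →
        (wordFrame A₁ α : EuclideanSpace ℝ (Fin 3) → EuclideanSpace ℝ (Fin 3)) '' ↑fccSlots =
          (wordFrame A₁ γ : EuclideanSpace ℝ (Fin 3) → EuclideanSpace ℝ (Fin 3)) '' ↑fccSlots → False :=
      fun α hl hc hP himg => false_of_map_reflection_eq (fun μ hμ => (hl μ hμ).1) (fun μ hμ => (hγl μ hμ).1) hP hγ2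
        hγlast (map_reflection_eq_of_image_eq A₁ hl hc hγl hγc himg)
    rcases eq_or_twin_of_coaxial e₁.frame e₂.frame hco with hEq | ⟨m, hm, hmenu, hEq⟩
    · have himg := image_fccSlots_eq_of_image_fcc_eq _ _ hEq
      rw [hF₁, himg₂] at himg
      exact main _ hαl hαc (length_le_one_or_getLast_pos _ hαpos) himg
    · set m' := e₁.frame.symm m with hm'
      have hm'u : ‖m'‖ = 1 := by rw [hm', LinearIsometryEquiv.norm_map, hm]
      have hm'm : ∀ w ∈ fccSlots, ⟪w, m'⟫_ℝ = 0 ∨ ⟪w, m'⟫_ℝ = Real.sqrt (2 / 3) ∨ ⟪w, m'⟫_ℝ = -Real.sqrt (2 / 3) := by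
        intro w hw
        rw [hm', ← LinearIsometryEquiv.inner_map_map e₁.frame, LinearIsometryEquiv.apply_symm_apply]
        exact hmenu w hw
      have htw : twinFrame e₁.frame m = wordFrame A₁ (m' :: stackWord (e₁ :: rest₁)) := by
        rw [twinFrame_eq_reflection_trans e₁.frame hm, wordFrame_cons, ← hm', ← hF₁]
      have himg := image_fccSlots_eq_of_image_fcc_eq _ _ hEq
      rw [himg₂, htw] at himg
      cases hα : stackWord (e₁ :: rest₁) with
      | nil =>
        rw [hα] at himg
        exact main [m'] (fun μ hμ => by rw [List.mem_singleton] at hμ; rw [hμ]; exact ⟨hm'u, hm'm⟩)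
          (List.isChain_singleton _) (Or.inl (by simp)) himg.symm
      | cons a α' =>
        rw [hα] at himg hαl hαc hαpos
        obtain ⟨hau, ham⟩ := hαl a List.mem_cons_self
        have hPtail : α'.length ≤ 1 ∨ ∃ lam, α'.getLast? = some lam ∧ ⟪u₁, lam⟫_ℝ = Real.sqrt (2 / 3) := by
          refine length_le_one_or_getLast_pos α' fun μ hμ => hαpos μ ?_
          cases α' with
          | nil => simp at hμ
          | cons b α'' => rw [List.getLast?_cons_cons]; exact hμ
        have hPfull : (m' :: a :: α').length ≤ 1 ∨
            ∃ lam, (m' :: a :: α').getLast? = some lam ∧ ⟪u₁, lam⟫_ℝ = Real.sqrt (2 / 3) := by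
          right
          obtain ⟨lam, hlam⟩ := Option.ne_none_iff_exists'.1
            (mt List.getLast?_eq_none_iff.1 (List.cons_ne_nil a α'))
          exact ⟨lam, by rw [List.getLast?_cons_cons, hlam], hαpos lam hlam⟩
        rcases inner_modelMenu hm'u hau hm'm ham with h | h | h | h
        · have hma : m' = a := (inner_eq_one_iff_of_norm_eq_one (𝕜 := ℝ) hm'u hau).1 h
          rw [wordFrame_cons_cons_cancel A₁ (by rw [hma]) α'] at himg
          exact main α' (fun μ hμ => hαl μ (List.mem_cons_of_mem a hμ)) hαc.tail hPtail himg.symm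
        · have hma : a = -m' := eq_neg_of_inner_eq_neg_one' hm'u hau h
          have hR : (ℝ ∙ m')ᗮ.reflection = (ℝ ∙ a)ᗮ.reflection := by rw [hma, reflection_neg_eq hm'u]
          rw [wordFrame_cons_cons_cancel A₁ hR α'] at himg
          exact main α' (fun μ hμ => hαl μ (List.mem_cons_of_mem a hμ)) hαc.tail hPtail himg.symm
        all_goals
          refine main (m' :: a :: α') (fun μ hμ => ?_) (List.isChain_cons.2 ⟨fun b hb => ?_, hαc⟩) hPfull himg.symm
          · rcases List.mem_cons.1 hμ with rfl | hμ'
            · exact ⟨hm'u, hm'm⟩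
            · exact hαl μ hμ'
          · rw [List.head?_cons, Option.mem_some_iff] at hb; rw [← hb]; first | exact Or.inl h | exact Or.inr h
  -- CASE ANALYSIS on the far word
  rcases List.eq_nil_or_concat β with hβ0 | ⟨L, b₁, hβ1⟩
  · -- no far letters: `γ = κ`, reduced of length 2 ending with `μk1 ⊥ u₁`: absurd
    exact (absurd_of_far κ hκl hκc hκ2 ⟨μk1, hκlast, hfirst⟩
      (by rw [himg₀, hβ0, List.map_nil, List.nil_append])).elim
  rw [List.concat_eq_append] at hβ1
  have hb₁ : b₁ ∈ β := by rw [hβ1]; simp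
  have hSb₁ := hβSl (S b₁) (List.mem_map.2 ⟨b₁, hb₁, rfl⟩)
  rcases Classical.em ((ℝ ∙ S b₁)ᗮ.reflection = (ℝ ∙ μk)ᗮ.reflection) with hcan | hncan
  swap
  · -- the junction is REDUCED: `γ = β.map S ++ κ`, length ≥ 3: absurd
    refine (absurd_of_far (β.map S ++ κ) ?_ ?_ (by rw [hκdef]; simp) ⟨μk1, by rw [List.getLast?_append, hκlast]; rfl, hfirst⟩
      himg₀).elim
    · intro μ hμ
      rcases List.mem_append.1 hμ with h | h
      · exact hβSl μ h
      · exact hκl μ h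
    · rw [List.isChain_append]
      refine ⟨hβSc, hκc, fun x hx y hy => ?_⟩
      have hx' : S b₁ = x := by rw [hβ1] at hx; simpa using hx
      have hy' : μk = y := by rw [hκdef] at hy; simpa using hy
      rw [← hx', ← hy']; exact hjunction _ _ hSb₁ hμk hncan
  rcases Classical.em (L = []) with hL | hL
  swap
  · -- `|β| ≥ 2` and the junction cancels: by the level-two hypothesis the next junction is reduced,
    -- `γ = (w.map S ++ [S b₂']) ++ [μk1]`, length ≥ 2: absurd
    rcases hP2far with hlen | ⟨w, b₂', b₁', hw₀, hdisj⟩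
    · exfalso; obtain ⟨l₀, L', rfl⟩ := List.exists_cons_of_ne_nil hL
      rw [← hβ, hβ1] at hlen; simp at hlen
    have hw : β = w ++ [b₂', b₁'] := by rw [hβ]; exact hw₀
    have hb₁' : b₁' = b₁ := by simpa using congrArg List.getLast? (hw.symm.trans hβ1)
    subst hb₁'
    have h2 : (ℝ ∙ S b₂')ᗮ.reflection ≠ (ℝ ∙ μk1)ᗮ.reflection := hdisj.resolve_left (fun h => h hcan)
    have hb₂' : b₂' ∈ β := by rw [hw]; simp
    have hSb₂ := hβSl (S b₂') (List.mem_map.2 ⟨b₂', hb₂', rfl⟩)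
    have hpre_mem : ∀ μ ∈ w.map S ++ [S b₂'], μ ∈ β.map S := by
      intro μ hμ
      rw [hw, List.map_append, List.map_cons, List.map_cons, List.map_nil]
      rcases List.mem_append.1 hμ with h | h
      · exact List.mem_append_left _ h
      · rw [List.mem_singleton] at h; rw [h]; simp
    have hpre_c : List.IsChain (fun μ μ' => ⟪μ, μ'⟫_ℝ = 1 / 3 ∨ ⟪μ, μ'⟫_ℝ = -1 / 3) (w.map S ++ [S b₂']) := by
      have h' : β.map S = (w.map S ++ [S b₂']) ++ [S b₁'] := by
        rw [hw, List.map_append, List.map_cons, List.map_cons, List.map_nil, List.append_assoc]; rfl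
      rw [h'] at hβSc
      exact (List.isChain_append.1 hβSc).1
    refine (absurd_of_far ((w.map S ++ [S b₂']) ++ [μk1]) ?_ ?_ (by simp) ⟨μk1, by simp, hfirst⟩ ?_).elim
    · intro μ hμ
      rcases List.mem_append.1 hμ with h | h
      · exact hβSl μ (hpre_mem μ h)
      · rw [List.mem_singleton] at h; rw [h]; exact hμk1
    · rw [List.isChain_append]
      refine ⟨hpre_c, List.isChain_singleton _, fun x hx y hy => ?_⟩
      have hx' : S b₂' = x := by simpa using hx
      have hy' : μk1 = y := by simpa using hy
      rw [← hx', ← hy']; exact hjunction _ _ hSb₂ hμk1 h2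
    · rw [himg₀, hw, List.map_append, List.map_cons, List.map_cons, List.map_nil, hκdef]
      rw [show (w.map S ++ [S b₂', S b₁']) ++ [μk, μk1] = (w.map S ++ [S b₂']) ++ S b₁' :: μk :: [μk1] by simp]
      rw [wordFrame_append_cons_cons_cancel A₁ _ hcan]
  -- THE SURVIVING CASE: `β = [b₁]` with `R_{S b₁} = R_{μk}`: the far top is grain 2's level-one entry through `±m`,
  -- its slot dozen is that of `wordFrame A₁ [μk1] = twinFrame A₁ (A₁ μk1)`
  subst hL
  rw [List.nil_append] at hβ1
  have himgT : (e₂.frame : EuclideanSpace ℝ (Fin 3) → EuclideanSpace ℝ (Fin 3)) '' ↑fccSlots =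
      (wordFrame A₁ [μk1] : EuclideanSpace ℝ (Fin 3) → EuclideanSpace ℝ (Fin 3)) '' ↑fccSlots := by
    rw [himg₀, hβ1, List.map_cons, List.map_nil, hκdef, List.singleton_append, wordFrame_cons_cons_cancel A₁ hcan]
  -- the near word is EMPTY (else a reduced comparison fails), so the near top is the bare bottom
  have hα0 : stackWord (e₁ :: rest₁) = [] := by
    by_contra hne
    -- `γ = [μk1]` has length 1; redo the comparison by hand
    rcases eq_or_twin_of_coaxial e₁.frame e₂.frame hco with hEq | ⟨m, hm, hmenu, hEq⟩
    · -- equal lattices: `α ≡ [μk1]`, so `α = [λ]` with `λ` positive on `u₁` and `R_λ = R_{μk1}`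
      have himg := image_fccSlots_eq_of_image_fcc_eq _ _ hEq
      rw [hF₁, himgT] at himg
      have hmap := map_reflection_eq_of_image_eq A₁ hαl hαc (fun μ hμ => by
        rw [List.mem_singleton] at hμ; rw [hμ]; exact hμk1) (List.isChain_singleton _) himg
      obtain ⟨lam, hlam⟩ := Option.ne_none_iff_exists'.1 (mt List.getLast?_eq_none_iff.1 hne)
      have hl := congrArg List.getLast? hmap
      rw [List.getLast?_map, List.getLast?_map, hlam] at hl
      simp only [List.getLast?_singleton, Option.map_some, Option.some.injEq] at hl
      have hlamu : ‖lam‖ = 1 := (hαl lam (List.mem_of_getLast? hlam)).1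
      have hpos := hαpos lam hlam
      rcases eq_or_eq_neg_of_reflection_eq hlamu hμk1.1 hl with h | h <;>
        [rw [h, hfirst] at hpos; rw [h, inner_neg_right, hfirst, neg_zero] at hpos] <;> linarith
    · -- mirror twins: `m' :: α ≡ [μk1]` up to one cancellation; lengths or last letters clash
      set m' := e₁.frame.symm m with hm'
      have hm'u : ‖m'‖ = 1 := by rw [hm', LinearIsometryEquiv.norm_map, hm]
      have hm'm : ∀ w ∈ fccSlots, ⟪w, m'⟫_ℝ = 0 ∨ ⟪w, m'⟫_ℝ = Real.sqrt (2 / 3) ∨ ⟪w, m'⟫_ℝ = -Real.sqrt (2 / 3) := by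
        intro w hw
        rw [hm', ← LinearIsometryEquiv.inner_map_map e₁.frame, LinearIsometryEquiv.apply_symm_apply]
        exact hmenu w hw
      have htw : twinFrame e₁.frame m = wordFrame A₁ (m' :: stackWord (e₁ :: rest₁)) := by
        rw [twinFrame_eq_reflection_trans e₁.frame hm, wordFrame_cons, ← hm', ← hF₁]
      have himg := image_fccSlots_eq_of_image_fcc_eq _ _ hEq
      rw [himgT, htw] at himg
      obtain ⟨a, α', hα⟩ := List.exists_cons_of_ne_nil hne
      rw [hα] at himg hαl hαc hαpos
      obtain ⟨hau, ham⟩ := hαl a List.mem_cons_self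
      -- the compared word `δ` (after a possible cancellation) is nonempty with last letter positive on `u₁`
      have key : ∀ δ : List (EuclideanSpace ℝ (Fin 3)),
          (∀ μ ∈ δ, ‖μ‖ = 1 ∧
            ∀ w ∈ fccSlots, ⟪w, μ⟫_ℝ = 0 ∨ ⟪w, μ⟫_ℝ = Real.sqrt (2 / 3) ∨ ⟪w, μ⟫_ℝ = -Real.sqrt (2 / 3)) →
          List.IsChain (fun μ μ' => ⟪μ, μ'⟫_ℝ = 1 / 3 ∨ ⟪μ, μ'⟫_ℝ = -1 / 3) δ →
          (∃ lam, δ.getLast? = some lam ∧ ⟪u₁, lam⟫_ℝ = Real.sqrt (2 / 3)) →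
          (wordFrame A₁ δ : EuclideanSpace ℝ (Fin 3) → EuclideanSpace ℝ (Fin 3)) '' ↑fccSlots =
            (wordFrame A₁ [μk1] : EuclideanSpace ℝ (Fin 3) → EuclideanSpace ℝ (Fin 3)) '' ↑fccSlots → False := by
        intro δ hδl hδc ⟨lam, hlam, hpos⟩ himg'
        have hmap := map_reflection_eq_of_image_eq A₁ hδl hδc (fun μ hμ => by
          rw [List.mem_singleton] at hμ; rw [hμ]; exact hμk1) (List.isChain_singleton _) himg'
        have hl := congrArg List.getLast? hmap
        rw [List.getLast?_map, List.getLast?_map, hlam] at hl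
        simp only [List.getLast?_singleton, Option.map_some, Option.some.injEq] at hl
        have hlamu : ‖lam‖ = 1 := (hδl lam (List.mem_of_getLast? hlam)).1
        rcases eq_or_eq_neg_of_reflection_eq hlamu hμk1.1 hl with h | h <;>
          [rw [h, hfirst] at hpos; rw [h, inner_neg_right, hfirst, neg_zero] at hpos] <;> linarith
      have hlastα : ∃ lam, (a :: α').getLast? = some lam ∧ ⟪u₁, lam⟫_ℝ = Real.sqrt (2 / 3) := by
        obtain ⟨lam, hlam⟩ := Option.ne_none_iff_exists'.1
          (mt List.getLast?_eq_none_iff.1 (List.cons_ne_nil a α'))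
        exact ⟨lam, hlam, hαpos lam hlam⟩
      rcases inner_modelMenu hm'u hau hm'm ham with h | h | h | h
      · -- `m' = a`: cancel; `α'` remains — empty (length clash) or with positive last letter
        have hma : m' = a := (inner_eq_one_iff_of_norm_eq_one (𝕜 := ℝ) hm'u hau).1 h
        rw [wordFrame_cons_cons_cancel A₁ (by rw [hma]) α'] at himg
        cases α' with
        | nil =>
          have hmap := map_reflection_eq_of_image_eq A₁ (fun μ hμ => by simp at hμ) List.isChain_nil
            (fun μ hμ => by rw [List.mem_singleton] at hμ; rw [hμ]; exact hμk1) (List.isChain_singleton _) himg.symm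
          simp at hmap
        | cons b α'' =>
          refine key (b :: α'') (fun μ hμ => hαl μ (List.mem_cons_of_mem a hμ)) hαc.tail ?_ himg.symm
          obtain ⟨lam, hlam, hpos⟩ := hlastα
          exact ⟨lam, by rw [List.getLast?_cons_cons] at hlam; exact hlam, hpos⟩
      · have hma : a = -m' := eq_neg_of_inner_eq_neg_one' hm'u hau h
        have hR : (ℝ ∙ m')ᗮ.reflection = (ℝ ∙ a)ᗮ.reflection := by rw [hma, reflection_neg_eq hm'u]
        rw [wordFrame_cons_cons_cancel A₁ hR α'] at himg
        cases α' with
        | nil =>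
          have hmap := map_reflection_eq_of_image_eq A₁ (fun μ hμ => by simp at hμ) List.isChain_nil
            (fun μ hμ => by rw [List.mem_singleton] at hμ; rw [hμ]; exact hμk1) (List.isChain_singleton _) himg.symm
          simp at hmap
        | cons b α'' =>
          refine key (b :: α'') (fun μ hμ => hαl μ (List.mem_cons_of_mem a hμ)) hαc.tail ?_ himg.symm
          obtain ⟨lam, hlam, hpos⟩ := hlastα
          exact ⟨lam, by rw [List.getLast?_cons_cons] at hlam; exact hlam, hpos⟩
      all_goals
        refine key (m' :: a :: α') (fun μ hμ => ?_) (List.isChain_cons.2 ⟨fun b hb => ?_, hαc⟩) ?_ himg.symm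
        · rcases List.mem_cons.1 hμ with rfl | hμ'
          · exact ⟨hm'u, hm'm⟩
          · exact hαl μ hμ'
        · rw [List.head?_cons, Option.mem_some_iff] at hb; rw [← hb]; first | exact Or.inl h | exact Or.inr h
        · obtain ⟨lam, hlam, hpos⟩ := hlastα
          exact ⟨lam, by rw [List.getLast?_cons_cons, hlam], hpos⟩
  -- so `rest₁ = []` and `e₁` is the bottom entry
  obtain rfl : rest₁ = [] := by
    have := length_stackWord_cons rest₁ e₁; rw [hα0] at this; exact List.length_eq_zero_iff.1 this.symm
  have he₁ : e₁ = ⟨A₁, u₁, 0⟩ := by simpa using hl₁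
  -- and `rest₂ = [bottom₂]`: `e₂` is grain 2's level-one entry
  have hlen₂ : rest₂.length = 1 := by
    have := length_stackWord_cons rest₂ e₂; rw [← hβ, hβ1] at this; simpa using this.symm
  obtain ⟨b, rfl⟩ := List.length_eq_one_iff.1 hlen₂
  obtain rfl : b = ⟨A₂, u₂, 0⟩ := by simpa using hl₂
  obtain ⟨hSo, hLi, -⟩ := hS₂
  obtain ⟨hdir, -, -⟩ := (stackWF_cons_cons z₂ e₂ ⟨A₂, u₂, 0⟩ []).1 hW₂
  have hn₁ : ‖e₂.nrm‖ = 1 := hSo.2.1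
  have hfr : e₂.frame = twinFrame A₂ e₂.nrm := frame_eq_twinFrame_of_link (e := e₂) (e' := ⟨A₂, u₂, 0⟩) hn₁ hLi
  -- the far letter: `b₁ = A₂⁻¹ e₂.nrm`, and `S b₁ = W⁻¹ e₂.nrm` is `±μk`
  have hb₁eq : b₁ = (A₂ : EuclideanSpace ℝ (Fin 3) ≃ₗᵢ[ℝ] EuclideanSpace ℝ (Fin 3)).symm e₂.nrm := by
    have : β = [(A₂ : EuclideanSpace ℝ (Fin 3) ≃ₗᵢ[ℝ] EuclideanSpace ℝ (Fin 3)).symm e₂.nrm] := by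
      rw [hβ, stackWord_cons_cons, stackWord_singleton]
    rw [hβ1] at this; simpa using this
  have hSb₁eq : S b₁ = (wordFrame A₁ κ).symm e₂.nrm := by
    rw [hb₁eq, hS, LinearIsometryEquiv.trans_apply, LinearIsometryEquiv.apply_symm_apply]
  have hpm : e₂.nrm = wordFrame A₁ κ μk ∨ e₂.nrm = -wordFrame A₁ κ μk := by
    have hu : ‖(wordFrame A₁ κ).symm e₂.nrm‖ = 1 := by rw [LinearIsometryEquiv.norm_map, hn₁]
    rw [hSb₁eq] at hcan
    rcases eq_or_eq_neg_of_reflection_eq hu hμk.1 hcan with h | h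
    · left; rw [← h, LinearIsometryEquiv.apply_symm_apply]
    · right; rw [← LinearIsometryEquiv.apply_symm_apply (wordFrame A₁ κ) e₂.nrm, h, map_neg]
  -- the capper data of `e₂`
  have hmenuT : ∀ w ∈ fccSlots, ⟪twinFrame A₂ e₂.nrm w, e₂.nrm⟫_ℝ = 0 ∨
      ⟪twinFrame A₂ e₂.nrm w, e₂.nrm⟫_ℝ = Real.sqrt (2 / 3) ∨ ⟪twinFrame A₂ e₂.nrm w, e₂.nrm⟫_ℝ = -Real.sqrt (2 / 3) := by
    rw [← hfr]; exact hSo.2.2.1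
  have hSne : (fccSlots.filter fun q => 0 < ⟪twinFrame A₂ e₂.nrm q, e₂.nrm⟫_ℝ).Nonempty := by
    obtain ⟨p, hp, hpn, -⟩ := exists_pos_slot_ne (twinFrame A₂ e₂.nrm) hn₁ hmenuT 0
    exact ⟨p, Finset.mem_filter.2 ⟨hp, by rw [hpn]; exact hr⟩⟩
  obtain ⟨hqS, hqmax⟩ := bestCapper_spec (twinFrame A₂ e₂.nrm) e₂.nrm z₂ hSne
  rw [Finset.mem_filter] at hqS
  have hq : e₂.dir = bestCapper (twinFrame A₂ e₂.nrm) e₂.nrm z₂ := by rw [hdir, hfr]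
  have hcap₂ : ⟪e₂.frame e₂.dir, A₁ μk1⟫_ℝ = 0 := by
    rw [hfr, hq]
    exact hcap e₂.nrm hpm hLi.2 _ hqS.1 hqS.2 (fun q' hq' hpos' => hqmax q' (Finset.mem_filter.2 ⟨hq', hpos'⟩))
  -- assemble
  rw [he₁]
  have hmenu₁ : ∀ w ∈ fccSlots, ⟪A₁ w, A₁ μk1⟫_ℝ = 0 ∨ ⟪A₁ w, A₁ μk1⟫_ℝ = Real.sqrt (2 / 3) ∨
      ⟪A₁ w, A₁ μk1⟫_ℝ = -Real.sqrt (2 / 3) := fun w hw => by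
    rw [LinearIsometryEquiv.inner_map_map]; exact hμk1.2 w hw
  refine ⟨hν1, hmenu₁, ?_, by rw [LinearIsometryEquiv.inner_map_map]; exact hfirst, hcap₂⟩
  -- `e₂.frame·Λ₀ = (wordFrame A₁ [μk1])·Λ₀ = (twinFrame A₁ (A₁ μk1))·Λ₀`
  have htw₁ : twinFrame A₁ (A₁ μk1) = wordFrame A₁ [μk1] := by
    rw [twinFrame_eq_reflection_trans A₁ hν1, LinearIsometryEquiv.symm_apply_apply]; rfl
  rw [htw₁]
  refine image_fcc_eq_of_slots_mem e₂.frame (wordFrame A₁ [μk1]) fun w hw => ?_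
  have hmem : e₂.frame w ∈ (wordFrame A₁ [μk1] : EuclideanSpace ℝ (Fin 3) → EuclideanSpace ℝ (Fin 3)) '' ↑fccSlots := by
    rw [← himgT]; exact ⟨w, Finset.mem_coe.2 hw, rfl⟩
  obtain ⟨w', hw', hEq⟩ := hmem
  exact ⟨w', mem_fcc_of_mem_fccSlots (Finset.mem_coe.1 hw'), hEq⟩

end Summit.Ventures.Crystal3D.Theorems

end
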